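import Summits.BirchSwinnertonDyer.BirchSwinnertonDyer.Theorems.ResidualThetaTransportAtTwoResidualSignedLambdaLowerCMAtTwoSupplyPlaceCut
import HarnessLib

/-!
# The SLACK RING of the one-pair glue: `ℤ₂`-slack ⟺ `ℤ`-slack along the `ℤ₂`-compatible pins `locd₂`, `𝒸`, `locd_S`
# (ASSEMBLY-SPEC-g19 clauses C1/C2 run `PlaceCutGlue` / `RelaxedDeepHalf` at `A := ℤ`; the registered S4₂ / S4₀ texts speak `ℤ₂`)

Route `ResidualThetaTransportAtTwo` (RTT), crux RSL_g `ResidualSignedLambdaLowerCMAtTwo` (stmt-BirchSwinnertonDyer-22608), line «onepair» (v3d);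
LEAD `prover-bsd-wall-rtt-p2` g19 (`--supports 22608 --as helper`, closes nothing). THEOREMS ONLY (no definition, no named fact, no instance, no
`sorry`). PORT BY NAME of the sorry-free crux sketch `Cruxes/ResidualThetaCountLowerPureAtTwo/Sketch_sidea_k1_g20.lean` (stub-ideation sidea-k1 g20,
commit d97fb2e53398 — credit), with its bare-function `actH` inlined as `fun a x ↦ C (ι a) • x`, plus the two `ℤ₂`-compatibilities of the pins it
consumes (`π.locd₂`, `π.cvec`; from w2's `locd₂_C_smul_eq_smul` / `colTuple_locd₂_C_smul`, p690209, fed with `pair_padicInt_smul_of_toZModPow` and the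
residue pin `π.hpair`). BSD is not proved by any of this; RSL_g is OPEN.

WHY (friction found by sidea-k1 g20, 08:10Z). `PlaceCutGlue.hDHrel_of_placeCut` and `RelaxedDeepHalf.deepHalfSigma_of_relaxed` are run at `A := ℤ`
(the relaxed Selmer subgroup `↥selRelSubgroup` carries no `ℤ₂`-structure; the cut forms `loc₂ (a₀ • s)`), so their inputs `h2`/`h0` need INTEGER
slack, while S4₂ (p702488) and S4₀ (v3d `stub_deepHalfAwayTwo`) conclude `∃ a : ℤ_[2], a ≠ 0 ∧ …`. Descent = unit stripping `a = u · 2^{v(a)}`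
(`PadicInt.unitCoeff_spec`), moving `u⁻¹` to the `x`-side through `C (ι u⁻¹) •` — which needs exactly the `ℤ₂`-compatibility of the target map and the
stability of the side condition `locd_S x = 0`; ascent `ℤ → ℤ₂` is the cast.

* §1 generic: `unitCoeff_inv_mul_eq_pow`, `exists_pow_slack_of_padicInt_slack(_of_stable)`, `exists_int_slack_of_padicInt_slack(_of_stable)`,
  `exists_padicInt_slack_of_int_slack(_of_stable)`, `padicInt_slack_iff_int_slack`.
* §2 pins (`locd₂ (C (ι a) • x) = a • locd₂ x` is `OnePairPins.locd₂_padicInt_smul'` of `…SupplyPlaceCut`), `OnePairPins.cvec_padicInt_smul` (`𝒸 (C (ι a) • x) = a • 𝒸 x`),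
  `AwayPins.exists_int_slack` (S4₀ descended), `AwayPins.slack_iff`, `AwayPins.exists_int_slack_atTwo` (S4₂ descended, side condition kept),
  `OnePair.exists_padicInt_slack_of_int_slack'` (ascent at the end of C2, N5 currency).

References: [Kobayashi2003] Thm. 7.3 ((7.17)–(7.21)); [Kato2004Asterisque] §12.2 (p. 220), §13.8 (p. 228); [SerreLocalFields1979] II §2.
-/

set_option autoImplicit false
-- the Theorems namespace of this sub repeats the summit name by design (D-0017 nested layout)
set_option linter.dupNamespace false

noncomputable section

open scoped Classical

namespace Summit.BirchSwinnertonDyer.BirchSwinnertonDyer.Theorems.OnePair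

/-! ## §1 Generic slack descent / ascent along a `ℤ_p`-compatible map (port of `Sketch_sidea_k1_g20` §1) -/

section Generic

variable {p : ℕ} [Fact p.Prime] {H M : Type*} [AddCommGroup M] [Module ℤ_[p] M]

/-- Unit stripping: `↑(unitCoeff ha)⁻¹ * a = p ^ v(a)` (`PadicInt.unitCoeff_spec`). [cite: SerreLocalFields1979, II §2] -/
theorem unitCoeff_inv_mul_eq_pow {a : ℤ_[p]} (ha : a ≠ 0) :
    (((PadicInt.unitCoeff ha)⁻¹ : ℤ_[p]ˣ) : ℤ_[p]) * a = (p : ℤ_[p]) ^ a.valuation := by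
  have hu := PadicInt.unitCoeff_spec ha
  calc (((PadicInt.unitCoeff ha)⁻¹ : ℤ_[p]ˣ) : ℤ_[p]) * a
      = (((PadicInt.unitCoeff ha)⁻¹ : ℤ_[p]ˣ) : ℤ_[p]) * ((PadicInt.unitCoeff ha : ℤ_[p]ˣ) * (p : ℤ_[p]) ^ a.valuation) :=
        congrArg (fun b : ℤ_[p] ↦ (((PadicInt.unitCoeff ha)⁻¹ : ℤ_[p]ˣ) : ℤ_[p]) * b) hu
    _ = (p : ℤ_[p]) ^ a.valuation := by rw [← mul_assoc, Units.inv_mul, one_mul]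

/-- **Descent to a power of `p`**: a `ℤ_p`-slack along an `act`-compatible map `f` is a `p^v`-slack, `v = v_p(a)`.
[cite: Kobayashi2003, Thm. 7.3 ((7.17)–(7.21))] -/
theorem exists_pow_slack_of_padicInt_slack (act : ℤ_[p] → H → H) (f : H → M)
    (hf : ∀ (a : ℤ_[p]) (x : H), f (act a x) = a • f x) {χ : M}
    (h : ∃ a : ℤ_[p], a ≠ 0 ∧ ∃ x : H, a • χ = f x) :
    ∃ v : ℕ, ∃ x : H, ((p : ℤ_[p]) ^ v) • χ = f x := by
  obtain ⟨a, ha, x, hx⟩ := h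
  refine ⟨a.valuation, act (((PadicInt.unitCoeff ha)⁻¹ : ℤ_[p]ˣ) : ℤ_[p]) x, ?_⟩
  rw [hf, ← hx, ← mul_smul, unitCoeff_inv_mul_eq_pow ha]

/-- The same with a side condition `P` stable under `act` (shape of S4₂'s `locd_S x = 0 ∧ a • z = locd₂ x`).
[cite: Kobayashi2003, Thm. 7.3 ((7.17)–(7.21))] -/
theorem exists_pow_slack_of_padicInt_slack_of_stable (act : ℤ_[p] → H → H) (f : H → M)
    (hf : ∀ (a : ℤ_[p]) (x : H), f (act a x) = a • f x) (P : H → Prop) (hP : ∀ (a : ℤ_[p]) (x : H), P x → P (act a x))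
    {z : M} (h : ∃ a : ℤ_[p], a ≠ 0 ∧ ∃ x : H, P x ∧ a • z = f x) :
    ∃ v : ℕ, ∃ x : H, P x ∧ ((p : ℤ_[p]) ^ v) • z = f x := by
  obtain ⟨a, ha, x, hPx, hx⟩ := h
  refine ⟨a.valuation, act (((PadicInt.unitCoeff ha)⁻¹ : ℤ_[p]ˣ) : ℤ_[p]) x, hP _ _ hPx, ?_⟩
  rw [hf, ← hx, ← mul_smul, unitCoeff_inv_mul_eq_pow ha]

/-- `((p : ℤ) ^ v : ℤ)` acts as `(p : ℤ_[p]) ^ v`. [cite: SerreLocalFields1979, II §2] -/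
theorem int_pow_smul_eq (v : ℕ) (χ : M) : (((p : ℤ) ^ v : ℤ)) • χ = ((p : ℤ_[p]) ^ v) • χ := by
  rw [← Int.cast_smul_eq_zsmul ℤ_[p] ((p : ℤ) ^ v) χ, Int.cast_pow, Int.cast_natCast]

/-- `(p : ℤ) ^ v ≠ 0`. [cite: SerreLocalFields1979, II §2] -/
theorem int_pow_ne_zero (v : ℕ) : ((p : ℤ) ^ v : ℤ) ≠ 0 :=
  pow_ne_zero _ (by exact_mod_cast (Fact.out : p.Prime).ne_zero)

/-- **Descent to `ℤ`**: a `ℤ_p`-slack along an `act`-compatible map is an integer slack. [cite: Kobayashi2003, Thm. 7.3 ((7.17)–(7.21))] -/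
theorem exists_int_slack_of_padicInt_slack (act : ℤ_[p] → H → H) (f : H → M)
    (hf : ∀ (a : ℤ_[p]) (x : H), f (act a x) = a • f x) {χ : M}
    (h : ∃ a : ℤ_[p], a ≠ 0 ∧ ∃ x : H, a • χ = f x) :
    ∃ m : ℤ, m ≠ 0 ∧ ∃ x : H, m • χ = f x := by
  obtain ⟨v, x, hx⟩ := exists_pow_slack_of_padicInt_slack act f hf h
  exact ⟨(p : ℤ) ^ v, int_pow_ne_zero v, x, by rw [int_pow_smul_eq, hx]⟩

/-- **Descent to `ℤ`, with a stable side condition.** [cite: Kobayashi2003, Thm. 7.3 ((7.17)–(7.21))] -/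
theorem exists_int_slack_of_padicInt_slack_of_stable (act : ℤ_[p] → H → H) (f : H → M)
    (hf : ∀ (a : ℤ_[p]) (x : H), f (act a x) = a • f x) (P : H → Prop) (hP : ∀ (a : ℤ_[p]) (x : H), P x → P (act a x))
    {z : M} (h : ∃ a : ℤ_[p], a ≠ 0 ∧ ∃ x : H, P x ∧ a • z = f x) :
    ∃ m : ℤ, m ≠ 0 ∧ ∃ x : H, P x ∧ m • z = f x := by
  obtain ⟨v, x, hPx, hx⟩ := exists_pow_slack_of_padicInt_slack_of_stable act f hf P hP h
  exact ⟨(p : ℤ) ^ v, int_pow_ne_zero v, x, hPx, by rw [int_pow_smul_eq, hx]⟩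

/-- **Ascent**: an integer slack is a `ℤ_p`-slack (the cast). [cite: Kobayashi2003, Thm. 7.3 ((7.17)–(7.21))] -/
theorem exists_padicInt_slack_of_int_slack (f : H → M) {χ : M}
    (h : ∃ m : ℤ, m ≠ 0 ∧ ∃ x : H, m • χ = f x) :
    ∃ a : ℤ_[p], a ≠ 0 ∧ ∃ x : H, a • χ = f x := by
  obtain ⟨m, hm, x, hx⟩ := h
  exact ⟨(m : ℤ_[p]), Int.cast_ne_zero.mpr hm, x, by rw [Int.cast_smul_eq_zsmul]; exact hx⟩

/-- Ascent with a side condition. [cite: Kobayashi2003, Thm. 7.3 ((7.17)–(7.21))] -/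
theorem exists_padicInt_slack_of_int_slack_of_stable (f : H → M) (P : H → Prop) {z : M}
    (h : ∃ m : ℤ, m ≠ 0 ∧ ∃ x : H, P x ∧ m • z = f x) :
    ∃ a : ℤ_[p], a ≠ 0 ∧ ∃ x : H, P x ∧ a • z = f x := by
  obtain ⟨m, hm, x, hPx, hx⟩ := h
  exact ⟨(m : ℤ_[p]), Int.cast_ne_zero.mpr hm, x, hPx, by rw [Int.cast_smul_eq_zsmul]; exact hx⟩

/-- **`ℤ_p`-slack ⟺ integer slack** along an `act`-compatible map. [cite: Kobayashi2003, Thm. 7.3 ((7.17)–(7.21))] -/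
theorem padicInt_slack_iff_int_slack (act : ℤ_[p] → H → H) (f : H → M)
    (hf : ∀ (a : ℤ_[p]) (x : H), f (act a x) = a • f x) (χ : M) :
    (∃ a : ℤ_[p], a ≠ 0 ∧ ∃ x : H, a • χ = f x) ↔ (∃ m : ℤ, m ≠ 0 ∧ ∃ x : H, m • χ = f x) :=
  ⟨exists_int_slack_of_padicInt_slack act f hf, exists_padicInt_slack_of_int_slack f⟩

end Generic

/-! ## §2 The line's currency: the `ℤ₂`-compatible pins and the descended S4₀ / S4₂ conclusions -/

section Pins

open Literature.NumberTheory.EllipticCurves Literature.NumberTheory.EllipticCurves.GreenbergSelmer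
open Literature.NumberTheory.GaloisRepresentations NumberField IsDedekindDomain Field
open Kobayashi2003 Rat.HeightOneSpectrum PowerSeries
open Summit.BirchSwinnertonDyer.BirchSwinnertonDyer.Theorems.ThetaTransport

variable {S : Set (PadicAlgCl 2)} {W : WeierstrassCurve ℚ} [W.IsElliptic] {κ : ZpExtension ℚ 2} {γ : absoluteGaloisGroup ℚ}
  {S₀ : Finset (HeightOneSpectrum (𝓞 ℚ))} {n : ℕ} {ρ : FramedGaloisRep ℚ ↥(padicCoeffIntegers S) 2}
  {Θ : ∀ v : HeightOneSpectrum (𝓞 ℚ), ((2 : ℕ) : 𝓞 ℚ) ∈ v.asIdeal → (Cofree ρ ↥(padicCoeffField S) ≃+ (Fin n → ↥(W.geomPrimaryTorsion 2)))}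
  {hΘ : ∀ v hv (δ : absoluteGaloisGroup (v.adicCompletion ℚ)) m i,
    Θ v hv (resGalOfEmb (closureEmb (K := ℚ) (v.adicCompletion ℚ)) δ • m) i = resGalOfEmb (closureEmb (K := ℚ) (v.adicCompletion ℚ)) δ • Θ v hv m i}
  {I : Kato2004.IwasawaH1DataCoeff (FramedGaloisRep.toGaloisRep ρ) 2 κ γ}
  {Sg : AddSubgroup (subgroupH1 κ.kerSubgroup (Cofree ρ ↥(padicCoeffField S)))} [Module ↥(padicCoeffIntegers S) ↥Sg]
  (π : OnePairPins S W κ γ S₀ n ρ Θ hΘ I Sg)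

/-- **`𝒸 (C (ι a) • x) = a • 𝒸 x`** for `𝒸 = col^{⊕n} ∘ locd₂` (w2's `colTuple_locd₂_C_smul` with `col := π.col`). [cite: Kobayashi2003, Thm. 6.2 (p. 18)]
[cite: Kato2004Asterisque, §12.2 (p. 220)] -/
theorem OnePairPins.cvec_padicInt_smul (a : ℤ_[2]) (x : I.H) :
    π.cvec ((PowerSeries.C (padicIntToCoeffIntegers S a) : IwasawaAlgebraO S) • x) = a • π.cvec x :=
  colTuple_locd₂_C_smul I W π.v
    (hPC := fun m y Q ↦ pair_padicInt_smul_of_toZModPow S ρ W π.ePk π.hμPk π.hadd₁Pk π.hadd₂Pk π.hgalPk (Θ π.v π.hv) κ π.v (hΘ π.v π.hv)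
      π.pair π.hpair m a y Q)
    (hlocd := π.hlocd₂) π.col x

variable [∀ w : ↥S₀, Module ℤ_[2] (Dloc S κ ρ (w : HeightOneSpectrum (𝓞 ℚ)))] (πₐ : AwayPins S κ ρ S₀ W γ n Θ hΘ I Sg π)

/-- **S4₀ descended**: the registered conclusion of `stub_deepHalfAwayTwo` (`ℤ₂`-slack on `P_{S₀}`) gives the INTEGER slack the `A := ℤ` place cut
consumes — from the field `AwayPins.hlocdS_smul` alone (port of sidea-k1 g20's `awayPins_exists_int_slack`). [cite: Kobayashi2003, Thm. 7.3 ((7.17)–(7.21))] -/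
theorem AwayPins.exists_int_slack {χ : PAway S κ ρ S₀} (h : ∃ a : ℤ_[2], a ≠ 0 ∧ ∃ x : I.H, a • χ = πₐ.locdS x) :
    ∃ m : ℤ, m ≠ 0 ∧ ∃ x : I.H, m • χ = πₐ.locdS x :=
  exists_int_slack_of_padicInt_slack (fun a x ↦ (PowerSeries.C (padicIntToCoeffIntegers S a) : IwasawaAlgebraO S) • x) πₐ.locdS
    (fun a x ↦ πₐ.hlocdS_smul a x) h

/-- **S4₀ ⟺ S4₀_ℤ** on each character. [cite: Kobayashi2003, Thm. 7.3 ((7.17)–(7.21))] -/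
theorem AwayPins.slack_iff (χ : PAway S κ ρ S₀) :
    (∃ a : ℤ_[2], a ≠ 0 ∧ ∃ x : I.H, a • χ = πₐ.locdS x) ↔ (∃ m : ℤ, m ≠ 0 ∧ ∃ x : I.H, m • χ = πₐ.locdS x) :=
  padicInt_slack_iff_int_slack (fun a x ↦ (PowerSeries.C (padicIntToCoeffIntegers S a) : IwasawaAlgebraO S) • x) πₐ.locdS
    (fun a x ↦ πₐ.hlocdS_smul a x) χ

/-- **S4₂ descended**: the registered conclusion of `stub_deepHalfAtTwoStrict` (`ℤ₂`-slack on `𝔉₂`, side condition `locd_S x = 0`) gives the integer slack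
with the side condition kept (port of sidea-k1 g20's `atTwo_exists_int_slack`; `locd₂`'s compatibility is `locd₂_padicInt_smul'`).
[cite: Kobayashi2003, Thm. 7.3 ((7.17)–(7.21))] [cite: MilneADT2006, Ch. I, Thm. 4.10] -/
theorem AwayPins.exists_int_slack_atTwo
    {z : (Fin n → ↥(Sprung2012.localTowerPointsOfEmb κ (closureEmb (K := ℚ) (π.v.adicCompletion ℚ)) W)) →+ ℤ_[2]}
    (h : ∃ a : ℤ_[2], a ≠ 0 ∧ ∃ x : I.H, πₐ.locdS x = 0 ∧ a • z = π.locd₂ x) :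
    ∃ m : ℤ, m ≠ 0 ∧ ∃ x : I.H, πₐ.locdS x = 0 ∧ m • z = π.locd₂ x :=
  exists_int_slack_of_padicInt_slack_of_stable (fun a x ↦ (PowerSeries.C (padicIntToCoeffIntegers S a) : IwasawaAlgebraO S) • x) π.locd₂
    (fun a x ↦ π.locd₂_padicInt_smul' a x) (fun x ↦ πₐ.locdS x = 0) (fun a x hx ↦ by
      change πₐ.locdS ((PowerSeries.C (padicIntToCoeffIntegers S a) : IwasawaAlgebraO S) • x) = 0
      rw [πₐ.hlocdS_smul, hx, smul_zero]) h

omit [W.IsElliptic] [Module ↥(padicCoeffIntegers S) ↥Sg] in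
/-- **Ascent at the end of the chain**: the `A := ℤ` output of the relaxed deep half (integer slack on `P`) is N5's `ℤ₂`-slack.
[cite: Kobayashi2003, Thm. 7.3 ((7.17)–(7.21))] -/
theorem exists_padicInt_slack_of_int_slack' {P : Type*} [AddCommGroup P] [Module ℤ_[2] P] (locd : I.H → P) {z : P}
    (h : ∃ m : ℤ, m ≠ 0 ∧ ∃ x : I.H, m • z = locd x) :
    ∃ a : ℤ_[2], a ≠ 0 ∧ ∃ x : I.H, a • z = locd x :=
  exists_padicInt_slack_of_int_slack locd h

end Pins

end Summit.BirchSwinnertonDyer.BirchSwinnertonDyer.Theorems.OnePair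

end
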